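import Summits.Ventures.Crystal3D.StickySpheres.BarlowChartSteps
import HarnessLib

/-!
# A word-uniform surface bound: clusters on ANY Barlow stacking have `≤ 6N − (9/2)N^{2/3}` contacts

HONEST FRAMING. Part of the venture `Summits/Ventures/Crystal3D` (cells `pub-crystal3d`,
`crystal3d-full`). An ON-LATTICE bound, uniform in the stacking word; nothing off-lattice, no
sharp constant, nothing about ground states or three-dimensional crystallization.

**Theorem** (`numContacts_le_of_mem_barlowStacking`). For every Hägg sequence `σ` and every unit
packing `x : Fin N → ℝ³` with all centres on the touching Barlow stacking
`barlowStacking 1 √(2/3) σ`: `numContacts x ≤ 6N − (9/2)·N^{2/3}` (all `N`).  A rung, uniform in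
the word, toward the cell's crux `StackingLiminf` (HOME/cf-p1/ROUTE.md §3.2/§13.3: the conjectured
sharp uniform constant is `∛432 = 7.5595…`; for the fcc word alone `FccLoomisWhitney.lean` gives
`6`).  No printed all-`N` bound of this kind is known to the cell for non-lattice stackings
(Bezdek 2012, Thm 1.1 (ii), `3.665…`, is for LATTICE packings; a Barlow stacking other than fcc is
not a lattice).

**Proof.** In the three sheared charts `χ₁ = (k, a, b)`, `χ₂ = (k, a+L, a+L+b)`,
`χ₃ = (k, a+b+L, b+L)` (`L = haggLabel σ k`; `BarlowChartSteps.lean`) every in-layer contact is a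
unit step in two charts and every cross-layer contact in one.  For each chart the occupied unit
steps plus the boundary pairs fill `6N` slots (`sum_card_stepNeighbors_add_card_boundaryPairs`)
and the boundary pairs number `≥ 6N^{2/3}` (tree: sharp edge-isoperimetric inequality in `ℤ³`,
`two_mul_card_mul_rpow_le_card_boundaryPairs`).  Hence, with `P` the ordered contact pairs
(`#P = 2C`), `#P + #P_inlayer ≤ 3(6N − 6N^{2/3})`; and `#P_crosslayer ≤ 6N` (three partners above,
three below).  Adding: `2#P ≤ 24N − 18N^{2/3}`.  (The method's constant `9/2` is optimal for three
charts with one column family each; two column families share a chart only when `L` is injective,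
i.e. for fcc.)

WHAT THIS IS NOT: not `StackingLiminf` (constant `∛432`); not a statement about `maxContacts`.
-/

noncomputable section

namespace Summit.Ventures.Crystal3D

open Finset
open Literature.Probability.LatticeModels (Site unitStep boundaryPairs
  two_mul_card_mul_rpow_le_card_boundaryPairs)
open Literature.MathematicalPhysics.StatisticalMechanics (barlowPos barlowStacking IsHaggSeq
  haggLabel sixOffsets threeOffsets card_threeOffsets dist_barlowPos_eq_iff
  le_dist_barlowPos_of_ideal)

/-- **Word-uniform surface bound.** For a Hägg sequence `σ` and a unit packing `x : Fin N → ℝ³`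
on `barlowStacking 1 √(2/3) σ`: `numContacts x ≤ 6N − (9/2) N^{2/3}`. -/
theorem numContacts_le_of_mem_barlowStacking (σ : ℤ → ℤ) (hσ : IsHaggSeq σ) {N : ℕ}
    (x : Fin N → EuclideanSpace ℝ (Fin 3)) (hx : IsUnitPacking x)
    (hmem : ∀ i, x i ∈ barlowStacking 1 (Real.sqrt (2 / 3)) σ) :
    (numContacts x : ℝ) ≤ 6 * (N : ℝ) - 9 / 2 * (N : ℝ) ^ ((2 : ℝ) / 3) := by
  classical
  rcases Nat.eq_zero_or_pos N with rfl | hNpos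
  · have h0 : numContacts x = 0 := by
      rw [numContacts, contactPairs, Finset.card_eq_zero, Finset.filter_eq_empty_iff]
      intro p; exact Fin.elim0 p.1
    rw [h0]; simp [Real.zero_rpow (by norm_num : (2 : ℝ) / 3 ≠ 0)]
  have hh : (Real.sqrt (2 / 3)) ^ 2 = 2 / 3 * (1 : ℝ) ^ 2 := by
    rw [Real.sq_sqrt (by norm_num)]; ring
  -- coordinates
  have hcoord : ∀ i, ∃ k a b : ℤ, x i = barlowPos 1 (Real.sqrt (2 / 3)) σ k a b := fun i => hmem i
  choose k a b hc using hcoord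
  have hinjx := hx.injective
  have hcoord_inj : ∀ i j, k i = k j → a i = a j → b i = b j → i = j := by
    intro i j h1 h2 h3
    apply hinjx; rw [hc i, hc j, h1, h2, h3]
  have hshell : ∀ i j, dist (x i) (x j) = 1 →
      (k j = k i ∧ (a i - a j, b i - b j) ∈ sixOffsets) ∨
      (k j = k i + 1 ∧ (a i - a j, b i - b j) ∈ threeOffsets (-σ (k i))) ∨
      (k j = k i - 1 ∧ (a i - a j, b i - b j) ∈ threeOffsets (σ (k i - 1))) := by
    intro i j hd
    rw [hc i, hc j] at hd
    exact (dist_barlowPos_eq_iff hσ one_pos hh _ _ _ _ _ _).1 hd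
  -- the three charts
  set c₁ : Fin N → Site 3 := fun i => ![k i, a i, b i] with hc₁
  set c₂ : Fin N → Site 3 := fun i =>
    ![k i, a i + haggLabel σ (k i), a i + haggLabel σ (k i) + b i] with hc₂
  set c₃ : Fin N → Site 3 := fun i =>
    ![k i, a i + b i + haggLabel σ (k i), b i + haggLabel σ (k i)] with hc₃
  have hinj₁ : Function.Injective c₁ := by
    intro i j h
    have h0 := congrFun h 0; have h1 := congrFun h 1; have h2 := congrFun h 2
    simp only [hc₁, Matrix.cons_val_zero, Matrix.cons_val_one, Matrix.cons_val] at h0 h1 h2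
    exact hcoord_inj i j h0 h1 h2
  have hinj₂ : Function.Injective c₂ := by
    intro i j h
    have h0 := congrFun h 0; have h1 := congrFun h 1; have h2 := congrFun h 2
    simp only [hc₂, Matrix.cons_val_zero, Matrix.cons_val_one, Matrix.cons_val] at h0 h1 h2
    have hL : haggLabel σ (k i) = haggLabel σ (k j) := by rw [h0]
    exact hcoord_inj i j h0 (by omega) (by omega)
  have hinj₃ : Function.Injective c₃ := by
    intro i j h
    have h0 := congrFun h 0; have h1 := congrFun h 1; have h2 := congrFun h 2
    simp only [hc₃, Matrix.cons_val_zero, Matrix.cons_val_one, Matrix.cons_val] at h0 h1 h2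
    have hL : haggLabel σ (k i) = haggLabel σ (k j) := by rw [h0]
    exact hcoord_inj i j h0 (by omega) (by omega)
  -- ordered contact pairs
  set P : Finset (Fin N × Fin N) :=
    univ.filter fun p => p.1 ≠ p.2 ∧ dist (x p.1) (x p.2) = 1 with hP
  have hPcard : P.card = 2 * numContacts x := by
    rw [← sum_coordination_eq, hP, card_filter, Fintype.sum_prod_type]
    refine sum_congr rfl fun i _ => ?_
    rw [coordination, contactNeighbors, card_filter]
    refine sum_congr rfl fun j _ => ?_
    by_cases hij : j = i
    · subst hij; simp
    · simp [hij, Ne.symm hij]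
  -- pairs realised as unit steps in a chart are controlled by the isoperimetric inequality
  have hchart : ∀ c : Fin N → Site 3, Function.Injective c →
      ((P.filter fun p => ∃ d : Fin 3, ∃ s : Bool, c p.2 = c p.1 + unitStep d s).card : ℝ) ≤
        6 * (N : ℝ) - 6 * (N : ℝ) ^ ((2 : ℝ) / 3) := by
    intro c hcinj
    set S := P.filter fun p => ∃ d : Fin 3, ∃ s : Bool, c p.2 = c p.1 + unitStep d s with hS
    -- fibre over the first ball
    have hfib : S.card ≤
        ∑ i, (univ.filter fun j => ∃ d : Fin 3, ∃ s : Bool, c j = c i + unitStep d s).card := by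
      rw [card_eq_sum_card_fiberwise (f := Prod.fst) (t := univ) fun p _ => mem_coe.2 (mem_univ _)]
      refine sum_le_sum fun i _ => ?_
      refine card_le_card_of_injOn Prod.snd (fun p hp => ?_) ?_
      · have hp' := mem_filter.1 (mem_coe.1 hp)
        obtain ⟨hpS, hpi⟩ := hp'
        obtain ⟨-, hstep⟩ := mem_filter.1 hpS
        rw [mem_coe, mem_filter]
        refine ⟨mem_univ _, ?_⟩
        rw [← hpi]; exact hstep
      · intro p hp q hq h
        have hp1 : p.1 = i := (mem_filter.1 (mem_coe.1 hp)).2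
        have hq1 : q.1 = i := (mem_filter.1 (mem_coe.1 hq)).2
        exact Prod.ext (hp1.trans hq1.symm) h
    have hslot := sum_card_stepNeighbors_add_card_boundaryPairs c hcinj
    have hcard : (univ.image c).card = N := by
      rw [card_image_of_injective _ hcinj, card_univ, Fintype.card_fin]
    have hne : (univ.image c).Nonempty := card_pos.1 (by rw [hcard]; exact hNpos)
    have hexp : (((3 : ℕ) : ℝ) - 1) / ((3 : ℕ) : ℝ) = (2 : ℝ) / 3 := by norm_num
    have hiso := two_mul_card_mul_rpow_le_card_boundaryPairs (d := 3) (by norm_num) _ hne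
    rw [hcard, hexp] at hiso
    have h1nat : S.card + (boundaryPairs (univ.image c)).card ≤ 2 * 3 * N := by omega
    have h1 : (S.card : ℝ) + (boundaryPairs (univ.image c)).card ≤ 2 * 3 * N := by
      exact_mod_cast h1nat
    push_cast at hiso h1
    linarith
  set S₁ := P.filter fun p => ∃ d : Fin 3, ∃ s : Bool, c₁ p.2 = c₁ p.1 + unitStep d s with hS₁
  set S₂ := P.filter fun p => ∃ d : Fin 3, ∃ s : Bool, c₂ p.2 = c₂ p.1 + unitStep d s with hS₂
  set S₃ := P.filter fun p => ∃ d : Fin 3, ∃ s : Bool, c₃ p.2 = c₃ p.1 + unitStep d s with hS₃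
  -- every in-layer pair is a step in two charts, every cross-layer pair in one
  have hpt : ∀ p ∈ P, (if k p.2 = k p.1 then 2 else 1) ≤
      (if p ∈ S₁ then 1 else 0) + (if p ∈ S₂ then 1 else 0) + (if p ∈ S₃ then 1 else 0) := by
    intro p hp
    have hd : dist (x p.1) (x p.2) = 1 := (mem_filter.1 hp).2.2
    rw [hc p.1, hc p.2] at hd
    have key := barlow_chart_steps σ hσ _ _ _ _ _ _ hd
    have e₁ : p ∈ S₁ ↔ ∃ d : Fin 3, ∃ s : Bool,
        (![k p.2, a p.2, b p.2] : Site 3) = ![k p.1, a p.1, b p.1] + unitStep d s := by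
      rw [hS₁, mem_filter]; exact ⟨fun h => h.2, fun h => ⟨hp, h⟩⟩
    have e₂ : p ∈ S₂ ↔ ∃ d : Fin 3, ∃ s : Bool,
        (![k p.2, a p.2 + haggLabel σ (k p.2), a p.2 + haggLabel σ (k p.2) + b p.2] : Site 3) =
          ![k p.1, a p.1 + haggLabel σ (k p.1), a p.1 + haggLabel σ (k p.1) + b p.1] +
            unitStep d s := by
      rw [hS₂, mem_filter]; exact ⟨fun h => h.2, fun h => ⟨hp, h⟩⟩
    have e₃ : p ∈ S₃ ↔ ∃ d : Fin 3, ∃ s : Bool,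
        (![k p.2, a p.2 + b p.2 + haggLabel σ (k p.2), b p.2 + haggLabel σ (k p.2)] : Site 3) =
          ![k p.1, a p.1 + b p.1 + haggLabel σ (k p.1), b p.1 + haggLabel σ (k p.1)] +
            unitStep d s := by
      rw [hS₃, mem_filter]; exact ⟨fun h => h.2, fun h => ⟨hp, h⟩⟩
    simp only [e₁, e₂, e₃]
    exact key
  -- summing the indicator inequality over `P`
  set Pin := P.filter fun p => k p.2 = k p.1 with hPin
  have hS₁P : S₁ ⊆ P := filter_subset _ _
  have hS₂P : S₂ ⊆ P := filter_subset _ _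
  have hS₃P : S₃ ⊆ P := filter_subset _ _
  have hsumL : ∑ p ∈ P, (if k p.2 = k p.1 then 2 else 1) = P.card + Pin.card := by
    have : ∀ p ∈ P, (if k p.2 = k p.1 then 2 else 1) = 1 + (if k p.2 = k p.1 then 1 else 0) := by
      intro p _; split_ifs <;> rfl
    rw [sum_congr rfl this, sum_add_distrib, sum_const, smul_eq_mul, mul_one, sum_boole, hPin]
    rfl
  have hsumR : ∑ p ∈ P, ((if p ∈ S₁ then 1 else 0) + (if p ∈ S₂ then 1 else 0) +
      (if p ∈ S₃ then 1 else 0)) = S₁.card + S₂.card + S₃.card := by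
    rw [sum_add_distrib, sum_add_distrib, sum_boole, sum_boole, sum_boole]
    simp only [Nat.cast_id]
    rw [filter_mem_eq_inter, filter_mem_eq_inter, filter_mem_eq_inter,
      inter_eq_right.2 hS₁P, inter_eq_right.2 hS₂P, inter_eq_right.2 hS₃P]
  have hsum : P.card + Pin.card ≤ S₁.card + S₂.card + S₃.card := by
    rw [← hsumL, ← hsumR]; exact sum_le_sum hpt
  -- cross-layer pairs: at most three above and three below each ball
  have hoff_inj : ∀ i (S : Finset (Fin N)) (m : ℤ), (∀ j ∈ S, k j = m) →
      Set.InjOn (fun j => (a i - a j, b i - b j)) ↑S := by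
    intro i S m hS j hj j' hj' heq
    simp only [Prod.mk.injEq] at heq
    exact hcoord_inj j j' ((hS j (mem_coe.1 hj)).trans (hS j' (mem_coe.1 hj')).symm)
      (by omega) (by omega)
  have hcross : ∀ (up : Bool), (P.filter fun p =>
      k p.2 = k p.1 + (if up then 1 else -1)).card ≤ 3 * N := by
    intro up
    set Q := P.filter fun p => k p.2 = k p.1 + (if up then 1 else -1) with hQ
    have hfib : ∀ i ∈ Q.image Prod.fst, (Q.filter fun p => p.1 = i).card ≤ 3 := by
      intro i _
      set S := (Q.filter fun p => p.1 = i).image Prod.snd with hS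
      have hScard : (Q.filter fun p => p.1 = i).card = S.card := by
        rw [hS, card_image_of_injOn]
        rintro p hp q hq (h : p.2 = q.2)
        exact Prod.ext (((mem_filter.1 (mem_coe.1 hp)).2).trans
          ((mem_filter.1 (mem_coe.1 hq)).2).symm) h
      have hmemS : ∀ j ∈ S, k j = k i + (if up then 1 else -1) ∧ dist (x i) (x j) = 1 := by
        intro j hj
        obtain ⟨p, hp, rfl⟩ := mem_image.1 hj
        obtain ⟨hpQ, hpi⟩ := mem_filter.1 hp
        obtain ⟨hpP, hk⟩ := mem_filter.1 hpQ
        have hd := (mem_filter.1 hpP).2.2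
        rw [hpi] at hk hd
        exact ⟨hk, hd⟩
      set τ : ℤ := if up then -σ (k i) else σ (k i - 1) with hτ
      have hSoff : ∀ j ∈ S, (a i - a j, b i - b j) ∈ threeOffsets τ := by
        intro j hj
        obtain ⟨hk, hd⟩ := hmemS j hj
        rcases hshell i j hd with ⟨h, -⟩ | ⟨h, h'⟩ | ⟨h, h'⟩
        · cases up <;> simp at hk <;> omega
        · cases up
          · simp at hk; omega
          · simpa [hτ] using h'
        · cases up
          · simpa [hτ] using h'
          · simp at hk; omega
      rw [hScard, ← card_threeOffsets τ, ← card_image_of_injOn (hoff_inj i S _ fun j hj =>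
        (hmemS j hj).1)]
      exact card_le_card fun v hv => by
        obtain ⟨j, hj, rfl⟩ := mem_image.1 hv
        exact hSoff j hj
    have h := card_le_mul_card_image Q 3 hfib
    have himg : (Q.image Prod.fst).card ≤ N := (card_le_univ _).trans (by rw [Fintype.card_fin])
    calc Q.card ≤ 3 * (Q.image Prod.fst).card := h
      _ ≤ 3 * N := Nat.mul_le_mul_left 3 himg
  have hPsplit : P.card = Pin.card + (P.filter fun p => ¬ k p.2 = k p.1).card := by
    rw [hPin]; exact (card_filter_add_card_filter_not _).symm
  have hPcol : (P.filter fun p => ¬ k p.2 = k p.1).card ≤ 6 * N := by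
    have hsub : (P.filter fun p => ¬ k p.2 = k p.1) ⊆
        (P.filter fun p => k p.2 = k p.1 + (if true then 1 else -1)) ∪
        (P.filter fun p => k p.2 = k p.1 + (if false then 1 else -1)) := by
      intro p hp
      obtain ⟨hpP, hk⟩ := mem_filter.1 hp
      have hd := (mem_filter.1 hpP).2.2
      rw [mem_union]
      rcases hshell p.1 p.2 hd with ⟨h, -⟩ | ⟨h, -⟩ | ⟨h, -⟩
      · exact absurd h hk
      · exact Or.inl (mem_filter.2 ⟨hpP, by simpa using h⟩)
      · exact Or.inr (mem_filter.2 ⟨hpP, by simp; omega⟩)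
    calc (P.filter fun p => ¬ k p.2 = k p.1).card
        ≤ ((P.filter fun p => k p.2 = k p.1 + (if true then 1 else -1)) ∪
            (P.filter fun p => k p.2 = k p.1 + (if false then 1 else -1))).card := card_le_card hsub
      _ ≤ _ := card_union_le _ _
      _ ≤ 3 * N + 3 * N := add_le_add (hcross true) (hcross false)
      _ = 6 * N := by ring
  -- assemble in `ℝ`
  have h₁ := hchart c₁ hinj₁
  have h₂ := hchart c₂ hinj₂
  have h₃ := hchart c₃ hinj₃
  have hnat : 2 * (2 * numContacts x) ≤ (S₁.card + S₂.card + S₃.card) + 6 * N := by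
    rw [← hPcard]; omega
  have hreal : (2 * (2 * numContacts x) : ℝ) ≤ (S₁.card + S₂.card + S₃.card : ℝ) + 6 * N := by
    exact_mod_cast hnat
  linarith

end Summit.Ventures.Crystal3D

end
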